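import Literature.AnabelianGeometry.SemiGraphs.Coverticial
import Literature.AnabelianGeometry.SemiGraphs.BranchSubgroupLemmas

/-!
# The transport of basepoints of `B(𝒢)` along an edge ([SemiAnbd] §2, Def. 2.1)

Mochizuki, *Semi-graphs of anabelioids*, Publ. RIMS **42** (2006), §2, the discussion following
Definition 2.1 (p. 22), on p. 23: "we have natural outer homomorphisms `Π_v → Π_𝒢`; `Π_b → Π_𝒢`" —
the homomorphisms `Π_b → Π_𝒢` for the two branches `b, b'` of an edge `e` (abutting to `v`, `v'`) are
both the homomorphism `Π_e → Π_𝒢` up to inner automorphism: the basepoints of `B(𝒢)` through `v`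
(induced from a basepoint `F_e` of `𝒢_e` along `b`) and through `v'` (induced along `b'`) are
identified by the gluing isomorphisms `ψ_b`, `ψ_{b'}` of the objects of `B(𝒢)`
[cite: MochizukiSemiAnbd2006, Def. 2.1 p.23].  Proof-only bookkeeping (cell abc-iut, layer L3, row
F-1477 / [SemiAnbd] Rmk. 2.10.1, sub-node (L4) "incidence of the level edges", seat abc-iut-L3-t12):

* `exists_edgePathIso` — the CANONICAL isomorphism of fibre functors
  `ε : ρ_v ⋙ (b^* ⋙ F_e) ≅ ρ_{v'} ⋙ (b'^* ⋙ F_e)`, `X ↦ F_e(ψ_b ≫ ψ_{b'}⁻¹)`, conjugates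
  `Π_e → Π_𝒢` (via `b`, basepoint through `v`) EXACTLY onto `Π_e → Π_𝒢` (via `b'`, basepoint through
  `v'`): the two branch embeddings of one edge group agree under this transport.

(The second branch is presented over an arbitrary edge `e` with `e(b) = e = e(b')` through
`SemiGraphOfAnabelioids.transportE`.)  No statement here takes a side on any disputed claim; nothing
about [IUTchIII] Cor. 3.12.
-/

namespace Literature.AnabelianGeometry.SemiGraphs

open CategoryTheory CategoryTheory.PreGaloisCategory
open Literature.AnabelianGeometry.Anabelioids

universe v₁ u₁ u

namespace SemiGraphOfAnabelioids

variable {𝒢 : SemiGraphOfAnabelioids.{v₁, u₁, u}}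

/-- `transportE` on the edge components of a morphism of `B(𝒢)`: conjugation by the `eqToHom`s of
`transportE_obj_T`. [cite: MochizukiSemiAnbd2006, Def. 2.2(i) p.23] -/
theorem transportE_map_fT {A B : 𝒢.BObj} (f : A ⟶ B) {e₁ e₂ : 𝒢.graph.Edge} (h : e₁ = e₂) :
    (𝒢.transportE h).map (f.fT e₁) =
      eqToHom (𝒢.transportE_obj_T A h) ≫ f.fT e₂ ≫ eqToHom (𝒢.transportE_obj_T B h).symm := by
  subst h
  simp [transportE]

/-- `transportE rfl` is the identity functor. [cite: MochizukiSemiAnbd2006, Def. 2.2(i) p.23] -/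
theorem transportE_rfl (e : 𝒢.graph.Edge) : 𝒢.transportE (rfl : e = e) = 𝟭 _ := rfl

/-- **The edge-path transport of basepoints.**  For an edge `e` with basepoint `F_e`, branches
`b, b' ∈ e` abutting to `v, v'`, there is an isomorphism of the induced basepoints of `B(𝒢)` through
`v` and through `v'` (namely `X ↦ F_e(ψ_b(X) ≫ ψ_{b'}(X)⁻¹)`) which conjugates the homomorphism
`Π_e → Π_𝒢` through `b` onto the homomorphism `Π_e → Π_𝒢` through `b'`.
[cite: MochizukiSemiAnbd2006, Def. 2.1 p.23] -/
theorem exists_edgePathIso {e : 𝒢.graph.Edge} (Fe : 𝒢.E e ⥤ FintypeCat.{v₁})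
    (b : 𝒢.graph.Branch) (v : 𝒢.graph.Vertex) (h : 𝒢.graph.abuts b = some v)
    (hb : 𝒢.graph.edgeOf b = e)
    (b' : 𝒢.graph.Branch) (v' : 𝒢.graph.Vertex) (h' : 𝒢.graph.abuts b' = some v')
    (hb' : 𝒢.graph.edgeOf b' = e) :
    ∃ ε : 𝒢.ρ v ⋙ ((𝒢.pull b v h).pullback ⋙ (𝒢.transportE hb ⋙ Fe)) ≅
        𝒢.ρ v' ⋙ ((𝒢.pull b' v' h').pullback ⋙ (𝒢.transportE hb' ⋙ Fe)),
      ∀ σ : Aut Fe,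
        Aut.autMulEquivOfIso ε
            (𝒢.piBToPi b v h (𝒢.transportE hb ⋙ Fe) (pi1Map (𝒢.transportE hb) Fe σ)) =
          𝒢.piBToPi b' v' h' (𝒢.transportE hb' ⋙ Fe) (pi1Map (𝒢.transportE hb') Fe σ) := by
  subst hb
  -- the comparison morphisms `m_X : b^* X_v ⟶ transportE (b'^* X_{v'})` in `𝒢_{e(b)}`
  let m : ∀ X : 𝒢.BObj,
      (𝒢.pull b v h).pullback.obj (X.S v) ≅
        (𝒢.transportE hb').obj ((𝒢.pull b' v' h').pullback.obj (X.S v')) := fun X =>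
    X.ψ b v h ≪≫ eqToIso (𝒢.transportE_obj_T X hb').symm ≪≫
      ((𝒢.transportE hb').mapIso (X.ψ b' v' h')).symm
  -- naturality of `m` in `X`
  have hm : ∀ {X Y : 𝒢.BObj} (f : X ⟶ Y),
      (𝒢.pull b v h).pullback.map (f.fS v) ≫ (m Y).hom =
        (m X).hom ≫ (𝒢.transportE hb').map ((𝒢.pull b' v' h').pullback.map (f.fS v')) := by
    intro X Y f
    have h1 : (𝒢.transportE hb').map ((𝒢.pull b' v' h').pullback.map (f.fS v')) =
        (𝒢.transportE hb').map (X.ψ b' v' h').hom ≫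
          (𝒢.transportE hb').map (f.fT (𝒢.graph.edgeOf b')) ≫
            (𝒢.transportE hb').map (Y.ψ b' v' h').inv := by
      rw [← Functor.map_comp, ← Functor.map_comp]
      congr 1
      rw [← Category.assoc, ← f.comm b' v' h', Category.assoc, Iso.hom_inv_id, Category.comp_id]
    have h2 := transportE_map_fT f hb'
    simp only [m, Iso.trans_hom, Iso.symm_hom, Functor.mapIso_inv, eqToIso.hom, Category.assoc]
    rw [reassoc_of% (f.comm b v h), h1, h2]
    simp only [Category.assoc, ← Functor.map_comp_assoc, Iso.inv_hom_id]
    simp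
  refine ⟨NatIso.ofComponents (fun X => Fe.mapIso (m X)) (fun {X Y} f => ?_), fun σ => ?_⟩
  · -- naturality of `ε`
    change Fe.map ((𝒢.pull b v h).pullback.map (f.fS v)) ≫ Fe.map (m Y).hom =
      Fe.map (m X).hom ≫ Fe.map ((𝒢.transportE hb').map ((𝒢.pull b' v' h').pullback.map (f.fS v')))
    rw [← Fe.map_comp, ← Fe.map_comp, hm]
  · -- conjugation of the branch homomorphisms: naturality of `σ` at `m_X`
    apply Iso.ext
    apply NatTrans.ext
    funext X
    change (Fe.mapIso (m X)).inv ≫ σ.hom.app _ ≫ (Fe.mapIso (m X)).hom = σ.hom.app _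
    rw [Functor.mapIso_inv, Functor.mapIso_hom]
    have hnat := σ.hom.naturality (m X).hom
    rw [← hnat, ← Category.assoc, ← Fe.map_comp, Iso.inv_hom_id, Fe.map_id, Category.id_comp]

end SemiGraphOfAnabelioids

end Literature.AnabelianGeometry.SemiGraphs
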